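import Summits.NavierStokesRegularity.NavierStokesRegularity.Theorems.QuantisedSymmetryPolyhedralDssProfileExistsDominatesBlowupProfile
import Summits.NavierStokesRegularity.NavierStokesRegularity.Theorems.FilamentSkeletonRssRdssProfileTruncation
import Summits.NavierStokesRegularity.NavierStokesRegularity.Theorems.QuantisedSymmetryLiouvilleKillsProfile
import Summits.NavierStokesRegularity.NavierStokesRegularity.Theorems.NavierStokesBreakdownR3
import Literature.Analysis.FluidPDE.LocalTypeI
import Literature.Analysis.FluidPDE.AlbrittonBarkerForwardHolds
import HarnessLib

/-!
# Strategist sketch S18·g5 (independent census, family `-s`) — crux `PolyhedralDssProfileExists`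
  (stmt-NavierStokesRegularity-1404, route `QuantisedSymmetry`)

Typed record of the three switches tried in the census `STRATEGY-CENSUS-s18.md`:

* §1 WEAKER INTERMEDIATES.  `X → W1 → W2 → ¬ S` is a chain of LANDED theorems
  (`stub_dominatesBlowupProfile`, the rotated-DSS truncation `filamentSkeletonRss_rdssProfileTruncation_proof`,
  `Blowup.closes` + `BlowupClayUniqueness_holds`), so the weakest in-tree closing intermediate is
  `W1 = Blowup.BlowupTypeIDssProfile` (stmt-0155, sector-free).  The DSS-free statements `W3G = ¬ #3`
  (`X → W3G` landed) and `W3 = NontrivialMildAncientTypeIExists ↔ LocalTypeISingularityExists`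
  (Albritton–Barker 2019 Thm 1.1, landed `AlbrittonBarkerTypeICharacterization_holds`) close the summit only
  through bridges that are NOT in the tree (`UnforcedLocalTruncation`, `ForcedLocalTruncation` to Clay (C),
  `NonautonomousSteering`), recorded as signatures.
* §2 DECOMPOSITIONS with proved assembly: Δ1 `ApproximantsExist → ApproximantsCompact → X` (P₂ provable
  support, P₁ ⇔ X); Δ3 `W3G → DssUpgrade → X` (upgrade has no tool).
* §3 REFORMULATION `X ↔ X12` (a witness for the tetrahedral rotation group of order 12 suffices), modulo the
  classification input `KleinReduction`.

Nothing here is proposed to `Theorems/`; no new `sorry`: open inputs are `def … : Prop` signatures.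
-/

noncomputable section

open MeasureTheory Set
open Literature.Analysis.FluidPDE

set_option linter.dupNamespace false
set_option linter.unusedVariables false

namespace Summit.NavierStokesRegularity.NavierStokesRegularity.Cruxes.PolyhedralDssProfileExists.StrategistS18g5

/-- Physical space. -/
abbrev R3 : Type := EuclideanSpace ℝ (Fin 3)

/-- The crux, by name. -/
abbrev X : Prop :=
  _root_.Summit.NavierStokesRegularity.NavierStokesRegularity.Theses.QuantisedSymmetry.PolyhedralDssProfileExists

/-- The group clauses of the crux (finite, proper rotations, irreducible on `ℝ³`). -/
def IsPolyhedral (G : Subgroup (R3 ≃ₗᵢ[ℝ] R3)) : Prop :=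
  Finite G ∧ (∀ g ∈ G, LinearMap.det (g.toLinearEquiv : R3 →ₗ[ℝ] R3) = 1) ∧
    (∀ V : Submodule ℝ R3, (∀ g ∈ G, ∀ v ∈ V, g v ∈ V) → V = ⊥ ∨ V = ⊤)

/-- The witness clauses of the crux for a given group `G` and factor `c`. -/
def IsWitness (G : Subgroup (R3 ≃ₗᵢ[ℝ] R3)) (c : ℝ) (u : ℝ → R3 → R3) : Prop :=
  IsAncientMildSolution 1 u ∧ (∀ t < 0, AEStronglyMeasurable (u t) volume) ∧ IsDiscretelySelfSimilar c u ∧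
    (∃ C₀ : ℝ, HasTypeIDecay C₀ u) ∧ (∀ g ∈ G, ∀ t x, u t (g x) = g (u t x)) ∧ ¬ (∀ t < 0, u t =ᵐ[volume] 0)

/-- Bundled form of the crux (bookkeeping). -/
theorem x_iff : X ↔ ∃ G, IsPolyhedral G ∧ ∃ c : ℝ, 1 < c ∧ ∃ u, IsWitness G c u := by
  constructor
  · rintro ⟨G, hfin, hdet, hirr, c, hc, u, h1, h2, h3, h4, h5, h6⟩
    exact ⟨G, ⟨hfin, hdet, hirr⟩, c, hc, u, h1, h2, h3, h4, h5, h6⟩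
  · rintro ⟨G, ⟨hfin, hdet, hirr⟩, c, hc, u, h1, h2, h3, h4, h5, h6⟩
    exact ⟨G, hfin, hdet, hirr, c, hc, u, h1, h2, h3, h4, h5, h6⟩

/-! ## §1 Weaker intermediates -/

/-- W1 = sector-free (rotated) Type-I DSS profile existence = crux stmt-0155 of route `Blowup`. -/
abbrev W1 : Prop := _root_.Summit.NavierStokesRegularity.NavierStokesRegularity.Theses.Blowup.BlowupTypeIDssProfile

/-- W2 = finite-time blow-up of a Leray–Hopf classical solution from a rapidly decaying smooth datum (X5a). -/
abbrev W2 : Prop := _root_.Summit.NavierStokesRegularity.NavierStokesRegularity.Theses.Blowup.BlowupExists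

/-- `X → W1` (landed: `stub_dominatesBlowupProfile`). -/
theorem w1_of_x : X → W1 :=
  _root_.Summit.NavierStokesRegularity.NavierStokesRegularity.Theorems.PolyhedralDssProfileExists.PolyhedralCell.stub_dominatesBlowupProfile

/-- `W1 → W2` through the LANDED conjecture-free rotated-DSS Type-I truncation bridge (stmt-11289). -/
theorem w2_of_w1 (h : W1) : W2 := by
  classical
  by_contra hW2
  apply h
  intro c
  have key : ∀ R : R3 ≃ₗᵢ[ℝ] R3, RotatedTypeIDSSLiouville c R := by
    intro R hc u hanc hmeas hdss hdec
    by_contra hnt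
    exact hW2
      (_root_.Summit.NavierStokesRegularity.NavierStokesRegularity.Theorems.filamentSkeletonRss_rdssProfileTruncation_proof
        ⟨c, R, u, hc, hanc, hmeas, hdss, hdec, hnt⟩)
  exact ⟨(rotatedTypeIDSSLiouville_refl_iff c).1 (key _), key⟩

/-- `W2 → ¬ S` (landed: `Blowup.closes` with `BlowupClayUniqueness_holds`). -/
theorem not_summit_of_w2 (h : W2) : ¬ _root_.NavierStokesRegularity :=
  _root_.Summit.NavierStokesRegularity.NavierStokesRegularity.Theses.Blowup.closes h
    _root_.Summit.NavierStokesRegularity.NavierStokesRegularity.Theses.Blowup.BlowupClayUniqueness_holds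

/-- The whole chain `X → ¬ S` through the sector-free intermediate. -/
theorem not_summit_of_x (h : X) : ¬ _root_.NavierStokesRegularity := not_summit_of_w2 (w2_of_w1 (w1_of_x h))

/-- W3G = negation of the route's kill switch #3 (`PolyhedralTypeILiouville`, stmt-1405): a nontrivial BOUNDED
`G`-equivariant Type-I ancient mild solution exists for some polyhedral `G` — DSS-free. -/
abbrev W3G : Prop :=
  ¬ _root_.Summit.NavierStokesRegularity.NavierStokesRegularity.Theses.QuantisedSymmetry.PolyhedralTypeILiouville

/-- `X → W3G` (landed: `quantisedSymmetry_liouvilleKillsProfile_proof`, time shift + DSS rescaling). -/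
theorem w3G_of_x (hX : X) : W3G := fun hL =>
  _root_.Summit.NavierStokesRegularity.NavierStokesRegularity.Theorems.quantisedSymmetry_liouvilleKillsProfile_proof hL hX

/-- W3 = Albritton–Barker's second bullet (sector-free, DSS-free). -/
abbrev W3 : Prop := NontrivialMildAncientTypeIExists

/-- `W3 ↔ LocalTypeISingularityExists` (Albritton–Barker 2019 Thm 1.1, LANDED). -/
theorem w3_iff_local : W3 ↔ LocalTypeISingularityExists := AlbrittonBarkerTypeICharacterization_holds.symm

/-- MISSING BRIDGE 1 (not in tree, not in print for Clay (A)): unforced truncation of a local Type-I singularity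
into a finite-time blow-up from a rapidly decaying smooth datum. The landed steering theorem needs an (R)DSS
fixed point of the period map; print truncations (Neustupa–Penel 1999, Tao 2013 localisation, Albritton–Barker
local regularity II) produce FORCED global solutions. -/
def UnforcedLocalTruncation : Prop := LocalTypeISingularityExists → W2

/-- MISSING BRIDGE 2 (print-level analysis, not in tree): forced Bogovskii truncation of a MILD Type-I singular
solution into Clay (C) (`NavierStokesBreakdownR3`, smooth rapidly decaying force allowed; the board rule D-0039
closes the summit on (C)). Needs time-smooth pressure on the truncation annulus (true for mild / global objects,
false for general local suitable weak solutions) and a forced Clay-uniqueness lemma. -/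
def ForcedLocalTruncation : Prop :=
  W3 → _root_.Summit.NavierStokesRegularity.NavierStokesRegularity.NavierStokesBreakdownR3

/-- MISSING BRIDGE 3 (new L-sized analysis): non-autonomous quasi-compact steering along the bounded similarity
orbit `U_k = c^{-k} u(-c^{-2k}, c^{-k} ·)` of a DSS-free Type-I ancient solution (the DSS case, a fixed point,
is the landed stmt-11289). -/
def NonautonomousSteering : Prop := W3G → W2

/-! ## §2 Decompositions with proved assembly -/

/-- Δ1, piece data: a `δ`-approximant = forced ancient mild solution (`ν = 1`) with weakly divergence-free
slices, scale-invariant force of size `δ`, measurable slices, `c`-DSS, Type-I constant `≤ Cbar`,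
`G`-equivariant, and a QUANTITATIVE non-triviality floor `ε₁` at `t = -1` inside radius `ρ`. -/
def IsApproximant (G : Subgroup (R3 ≃ₗᵢ[ℝ] R3)) (c Cbar ε₁ ρ δ : ℝ) (u : ℝ → R3 → R3) : Prop :=
  (∀ t < 0, IsWeaklyDivFree (u t)) ∧
  (∃ f : ℝ → R3 → R3, (∀ t < 0, ∀ x, ‖f t x‖ ≤ δ / (‖x‖ + Real.sqrt (-t)) ^ 3) ∧
      ∀ s t : ℝ, s < t → t < 0 → IsMildNSSolutionBetween 1 f u s t) ∧
  (∀ t < 0, AEStronglyMeasurable (u t) volume) ∧ IsDiscretelySelfSimilar c u ∧ HasTypeIDecay Cbar u ∧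
  (∀ g ∈ G, ∀ t x, u t (g x) = g (u t x)) ∧
  (∃ x : R3, ‖x‖ ≤ ρ ∧ ε₁ ≤ ‖u (-1) x‖)

/-- Δ1, P₁: approximants with arbitrarily small scale-invariant force exist in one sector with a uniform Type-I
constant and a uniform floor.  (`X → P₁` with `f = 0` modulo the small-constant Liouville floor; `P₁ → X` is P₂:
P₁ is `X`-equivalent — small-force ancient DSS solutions exist perturbatively but lie BELOW the floor.) -/
def ApproximantsExist : Prop :=
  ∃ G, IsPolyhedral G ∧ ∃ c : ℝ, 1 < c ∧ ∃ Cbar ε₁ ρ : ℝ, 0 < ε₁ ∧ ∀ δ > 0, ∃ u, IsApproximant G c Cbar ε₁ ρ δ u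

/-- Δ1, P₂ (support-level, provable): compactness — uniform Type-I bound + DSS + equivariance + vanishing force
give a `C_loc` subsequential limit which is an exact witness; the floor survives by parabolic regularity. -/
def ApproximantsCompact : Prop :=
  ∀ G, IsPolyhedral G → ∀ c : ℝ, 1 < c → ∀ Cbar ε₁ ρ : ℝ, 0 < ε₁ →
    (∀ δ > 0, ∃ u, IsApproximant G c Cbar ε₁ ρ δ u) → ∃ u, IsWitness G c u

/-- Δ1 assembly (PROVED; trivial seam). -/
theorem x_of_approximants (h₁ : ApproximantsExist) (h₂ : ApproximantsCompact) : X := by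
  obtain ⟨G, hG, c, hc, Cbar, ε₁, ρ, hε, happ⟩ := h₁
  exact x_iff.2 ⟨G, hG, c, hc, h₂ G hG c hc Cbar ε₁ ρ hε happ⟩

/-- The ε-regularity floor making `X → ApproximantsExist` (KNSS 2009; Chae–Wolf 2017 Rmk 1.4): ancient mild
solutions with a SMALL Type-I time constant vanish.  Signature only. -/
def SmallConstantLiouville : Prop :=
  ∃ ε₁ > 0, ∀ u : ℝ → R3 → R3, IsAncientMildSolution 1 u → (∀ t < 0, AEStronglyMeasurable (u t) volume) →
    HasTypeITimeDecay ε₁ u → ∀ t < 0, u t =ᵐ[volume] 0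

/-- Δ3, the Liouville dichotomy split: the missing piece "a bounded `G`-equivariant Type-I ancient nontrivial
solution can be UPGRADED to a DSS one" — no tool (ω-limit sets of the similarity flow need not contain periodic
orbits). -/
def DssUpgrade : Prop := W3G → X

/-- Δ3 assembly (PROVED; modus ponens). -/
theorem x_of_dichotomy (h : W3G) (hU : DssUpgrade) : X := hU h

/-! ## §3 Reformulation: the tetrahedral sector suffices -/

/-- Classification input (F. Klein 1884: the finite irreducible subgroups of `SO(3)` are `T ≅ A₄`, `O ≅ S₄`,
`I ≅ A₅`, and `T ≤ O`, `T ≤ I`): every polyhedral `G` contains a polyhedral subgroup of order 12.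
Signature only (provable, M-sized in Lean). -/
def KleinReduction : Prop :=
  ∀ G : Subgroup (R3 ≃ₗᵢ[ℝ] R3), IsPolyhedral G →
    ∃ H : Subgroup (R3 ≃ₗᵢ[ℝ] R3), H ≤ G ∧ Nat.card H = 12 ∧ IsPolyhedral H

/-- X12: a witness equivariant under a polyhedral group of order 12 (the chiral tetrahedral group = the three
half-turns about the coordinate axes and the cyclic permutation of coordinates, up to conjugacy). -/
def X12 : Prop := ∃ G, IsPolyhedral G ∧ Nat.card G = 12 ∧ ∃ c : ℝ, 1 < c ∧ ∃ u, IsWitness G c u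

/-- `X ↔ X12` modulo `KleinReduction` (PROVED): the `∃ G` quantifier of the crux is spurious — the symmetry
lever is capped at the order-12 sector; there is no large parameter inside the irreducible class. -/
theorem x_iff_x12 (hK : KleinReduction) : X ↔ X12 := by
  constructor
  · intro hX
    obtain ⟨G, hG, c, hc, u, hu⟩ := x_iff.1 hX
    obtain ⟨H, hHG, hcard, hH⟩ := hK G hG
    obtain ⟨h1, h2, h3, h4, h5, h6⟩ := hu
    exact ⟨H, hH, hcard, c, hc, u, h1, h2, h3, h4, fun g hg => h5 g (hHG hg), h6⟩
  · rintro ⟨G, hG, -, c, hc, u, hu⟩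
    exact x_iff.2 ⟨G, hG, c, hc, u, hu⟩

end Summit.NavierStokesRegularity.NavierStokesRegularity.Cruxes.PolyhedralDssProfileExists.StrategistS18g5

end
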